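import Summits.ABC.IUTFork.LDHGenuinePrintIsmHexFamilyBounds
import Summits.ABC.IUTFork.LDHGenuinePrintIsmHexOne
import HarnessLib

/-!
# The fork at [IUTchIII] Corollary 3.12, L-DH level — PRINT's (Ind2) on the whole HEX family `λ_k = 1/2 + 2/7^k`, `1 ≤ k ≤ 16`:
# the Szpiro-SHALLOW criterion DECIDED at every prime level `l ≥ 5` (arithmetic part 2 of 3)

Record-only PROOF file (D-0012) of the abc-iut cell (seat abc-iut-c312-d1, gen 12; row «C:PRINT-ISM-HEX-FAMILY», the print-Ism twin of
abc-iut-C-cert-3's «C:PERIMAGE-HEX» container rows `LDHGenuinePerImageUniformShellRowsHex{A,B,C,D}.lean`). TAKES NO SIDE on [IUTchIII] Cor. 3.12.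
CLASSICAL ARITHMETIC ONLY; the datum-level consequences are drawn in part 3 `LDHGenuinePrintIsmHexFamily.lean`.

By part 7 of «C:PERIMAGE-PRINT-ISM» (`Cor22.ThetaVolumeDatumAt.perImage_printInd2_iff_shallow` / `…union_printInd2_iff_shallow_of_j_mem_range`,
p516974) the per-image / union inequality of the cell's L-DH Corollary computed over PRINT's factorwise `Ism` (Ind2) (abc-iut-c312-1's `Real.ismIsm`)
holds at a genuine Θ-volume datum of `(P, l)`, `λ_P ∈ U`, IFF the bare pilot degrees satisfy the Szpiro-SHALLOW inequality
`((l+1)/24 − 1/(2l))·log q^{∤{2,l}}(λ_P) ≤ ((l+5)/4)·log π`. This file DECIDES that inequality on the HEX family, uniformly in the prime `l`: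

* `HexPrintIsm.log_pi_lt` (`log π < 1.1558`, from `log x ≤ x − 1` at `x = π/e`), `HexPrintIsm.exp_fifteen_lt`, `HexPrintIsm.exp_five_lt`;
* **`HexPrintIsm.not_shallow_of_le`** — the monotone comparison: if `κ_{l₀}·Q₀ > ((l₀+5)/4)·1.1558` with `Q₀ ≥ 7`, the shallow inequality FAILS at
  every `l ≥ l₀` for every `Q ≥ Q₀` (`κ_l = (l+1)/24 − 1/(2l)` gains `≥ (l−l₀)/24` while the allowance gains `< (l−l₀)·1.1558/4 ≤ (l−l₀)·Q₀/24`);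
  `HexPrintIsm.shallow_of_le` — the TRUE direction from an upper bound and `log π > 1`;
* `k = 2` (`λ₂ = 53/98`, `45 + 53 = 98`): **`fifteen_le_logQAvoid_lamSeven_two`** (every prime `l`, `M = 53²`) and **`twenty_le_logQAvoid_lamSeven_two_five`**
  (the pole `l = 5` exactly: `q^{∤{2,5}}(53/98) = 3⁴·7⁴·53² = 546297129 > e^{20}`);
* `k = 1` (`λ₁ = 11/14`, `3 + 11 = 14`; exact values by gen 11's `Hex1.logQAvoid_pair_of_prime`, p519422): `logQAvoid_hexOne_five_le` (`≤ 11.1`),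
  `logQAvoid_hexOne_seven_le` (`≤ 8.32`, pole), `ten_le_logQAvoid_hexOne` (`≥ 10` at every prime `l ≥ 13`);
* **`HexPrintIsm.shallow_hexOne_iff`** — at `k = 1`, for a prime `l ≥ 5`: SHALLOW ⟺ `l ≤ 11` (i.e. exactly `l ∈ {5, 7, 11}`; `l = 11` is gen 11's
  `Hex1.shallow_eleven`);
* **`HexPrintIsm.not_shallow_lamSeven`** — for EVERY `2 ≤ k ≤ 16` and EVERY prime `l ≥ 5` the shallow inequality FAILS at `λ_k`
  (part 1's `twenty_le_logQAvoid_lamSeven_of_le_sixteen` for `k ≥ 3`, base `(l₀, Q₀) = (5, 20)`; `k = 2`: bases `(7, 15)` and, at `l = 5`, `(5, 20)`).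

DESK CROSS-CHECK (python, exact rationals; not kernel): margins of the three bases `(5,20)`: 3.0000 − 2.8895, `(7,15)`: 3.9286 − 3.4674, `(13,10)`:
5.4487 − 5.2011; `log π = 1.14473`, `e^{20} = 485165195.41`, `e^{15} = 3269017.37`.

HONEST SCOPE. Pure statements about rational numbers and logarithms; which Θ-volume data exist at `(λ_k, l)` is not touched here. Nothing here
asserts [IUTchIII] Cor. 3.12, the existence of Θ-data, or abc; decided-AS-TYPED (over OUR typing of print's (Ind2)) ≠ decided-in-print.
[cite: Mochizuki2012, IUTchIV Thm. 1.10 p. 22–23, Step (viii) p. 30; Cor. 2.2 (ii) proof (P5) p. 46] [cite: MochizukiGenEll2010, Ex. 1.3 (i) p. 5, Def. 3.3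
p. 12] [claim: Mochizuki2012, status: disputed] for every IUT quotation. PROOF-ONLY (no `def`, no new `Prop`, no instance, no notation).
-/

noncomputable section

open NumberField IsDedekindDomain

namespace Literature.IUT.LogVolume.Cor22

open Summit.ABC.IUTFork Literature.NumberTheory.DiophantineGeometry Literature.NumberTheory.DiophantineGeometry.GenEll

namespace HexPrintIsm

/-! ## 1. Real constants and the monotone «not shallow» comparison -/

/-- `log π < 1.1558` (`log(π/e) ≤ π/e − 1`, `π < 3.141593`, `e > 2.7182818283`). [folklore] -/
theorem log_pi_lt : Real.log Real.pi < 1.1558 := by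
  have he := Real.exp_one_gt_d9
  have hpi := Real.pi_lt_d6
  have hpos : 0 < Real.pi / Real.exp 1 := div_pos Real.pi_pos (Real.exp_pos 1)
  have h1 := Real.log_le_sub_one_of_pos hpos
  rw [Real.log_div Real.pi_pos.ne' (Real.exp_pos 1).ne', Real.log_exp] at h1
  have h2 : Real.pi / Real.exp 1 < 1.1558 := by
    rw [div_lt_iff₀ (Real.exp_pos 1)]
    linarith
  linarith

/-- `e^{15} < 3269018` (`e < 2.7182818286`). [folklore] -/
theorem exp_fifteen_lt : Real.exp 15 < 3269018 := by
  have h : Real.exp 15 = Real.exp 1 ^ 15 := by rw [← Real.exp_nat_mul]; norm_num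
  rw [h]
  have hlt : Real.exp 1 ^ 15 < (2.7182818286 : ℝ) ^ 15 :=
    pow_lt_pow_left₀ Real.exp_one_lt_d9 (Real.exp_pos 1).le (by norm_num)
  have hnum : (2.7182818286 : ℝ) ^ 15 < 3269018 := by norm_num
  linarith

/-- `e^{5} < 148.5` (`e < 2.7182818286`). [folklore] -/
theorem exp_five_lt : Real.exp 5 < 148.5 := by
  have h : Real.exp 5 = Real.exp 1 ^ 5 := by rw [← Real.exp_nat_mul]; norm_num
  rw [h]
  have hlt : Real.exp 1 ^ 5 < (2.7182818286 : ℝ) ^ 5 :=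
    pow_lt_pow_left₀ Real.exp_one_lt_d9 (Real.exp_pos 1).le (by norm_num)
  have hnum : (2.7182818286 : ℝ) ^ 5 < 148.5 := by norm_num
  linarith

/-- **The monotone «NOT shallow» comparison.** If at a base level `l₀ > 0` and a base value `Q₀ ≥ 7` the strict inequality
`((l₀+5)/4)·1.1558 < κ_{l₀}·Q₀` holds (`κ_l = (l+1)/24 − 1/(2l)`), then for every `l ≥ l₀` and every `Q ≥ Q₀` the Szpiro-shallow
inequality `κ_l·Q ≤ ((l+5)/4)·log π` FAILS: `κ_l − κ_{l₀} ≥ (l − l₀)/24`, while the allowance grows by `(l − l₀)/4·log π < (l − l₀)/4·1.1558 ≤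
(l − l₀)/24·Q₀` because `Q₀ ≥ 7 > 6·1.1558`. [folklore] -/
theorem not_shallow_of_le {l₀ Q₀ Q : ℝ} {l : ℕ} (hl₀ : 0 < l₀) (hQ₀ : 7 ≤ Q₀)
    (hbase : (l₀ + 5) / 4 * 1.1558 < ((l₀ + 1) / 24 - 1 / (2 * l₀)) * Q₀)
    (hl : l₀ ≤ (l : ℝ)) (hQ : Q₀ ≤ Q) :
    ¬ ((((l : ℝ) + 1) / 24 - 1 / (2 * l)) * Q ≤ ((l : ℝ) + 5) / 4 * Real.log Real.pi) := by
  intro h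
  have hπ := log_pi_lt
  have hlpos : (0 : ℝ) < l := lt_of_lt_of_le hl₀ hl
  have hQ₀pos : (0 : ℝ) < Q₀ := by linarith
  -- `κ_{l₀} > 0`
  have hκ₀ : 0 < (l₀ + 1) / 24 - 1 / (2 * l₀) := by
    have hp : (0 : ℝ) < (l₀ + 5) / 4 * 1.1558 := by positivity
    exact (mul_pos_iff_of_pos_right hQ₀pos).1 (lt_trans hp hbase)
  -- `κ_l ≥ κ_{l₀} + (l − l₀)/24`
  have hinv : 1 / (2 * (l : ℝ)) ≤ 1 / (2 * l₀) := one_div_le_one_div_of_le (by positivity) (by linarith)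
  have hκ : (l₀ + 1) / 24 - 1 / (2 * l₀) + ((l : ℝ) - l₀) / 24 ≤ ((l : ℝ) + 1) / 24 - 1 / (2 * l) := by linarith
  have hκl : 0 < ((l : ℝ) + 1) / 24 - 1 / (2 * l) := by
    have : 0 ≤ ((l : ℝ) - l₀) / 24 := by linarith
    linarith
  -- `κ_l·Q ≥ κ_l·Q₀ ≥ (κ_{l₀} + (l − l₀)/24)·Q₀`
  have h1 : (((l : ℝ) + 1) / 24 - 1 / (2 * l)) * Q₀ ≤ (((l : ℝ) + 1) / 24 - 1 / (2 * l)) * Q :=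
    mul_le_mul_of_nonneg_left hQ hκl.le
  have h2 : ((l₀ + 1) / 24 - 1 / (2 * l₀) + ((l : ℝ) - l₀) / 24) * Q₀ ≤ (((l : ℝ) + 1) / 24 - 1 / (2 * l)) * Q₀ :=
    mul_le_mul_of_nonneg_right hκ hQ₀pos.le
  -- the allowance: `((l+5)/4)·log π ≤ ((l₀+5)/4)·1.1558 + ((l − l₀)/4)·1.1558`
  have h3 : ((l : ℝ) + 5) / 4 * Real.log Real.pi ≤ ((l : ℝ) + 5) / 4 * 1.1558 :=
    mul_le_mul_of_nonneg_left hπ.le (by linarith)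
  -- `((l − l₀)/4)·1.1558 ≤ ((l − l₀)/24)·Q₀`
  have h4 : ((l : ℝ) - l₀) / 4 * 1.1558 ≤ ((l : ℝ) - l₀) / 24 * Q₀ := by
    have hc : (1.1558 : ℝ) / 4 ≤ Q₀ / 24 := by linarith
    have := mul_le_mul_of_nonneg_left hc (sub_nonneg.2 hl)
    linarith
  nlinarith

/-- **SHALLOW from an upper bound**: if `κ_l·B ≤ (l+5)/4` and `Q ≤ B` (with `κ_l ≥ 0`), then `κ_l·Q ≤ ((l+5)/4)·log π` (`log π > 1`). [folklore] -/
theorem shallow_of_le {B Q : ℝ} {l : ℕ} (hκ : 0 ≤ ((l : ℝ) + 1) / 24 - 1 / (2 * l)) (hQ : Q ≤ B)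
    (hB : (((l : ℝ) + 1) / 24 - 1 / (2 * l)) * B ≤ ((l : ℝ) + 5) / 4) :
    (((l : ℝ) + 1) / 24 - 1 / (2 * l)) * Q ≤ ((l : ℝ) + 5) / 4 * Real.log Real.pi := by
  -- `1 < log π` (`e < 2.72 < 3 < π`; the tree's `Literature.NumberTheory.LFunctions.NumberField.one_lt_log_pi`, inlined to keep the imports light)
  have hπ : 1 < Real.log Real.pi := by
    rw [Real.lt_log_iff_exp_lt Real.pi_pos]
    have := Real.exp_one_lt_d9
    linarith [Real.pi_gt_three]
  have h1 : (((l : ℝ) + 1) / 24 - 1 / (2 * l)) * Q ≤ (((l : ℝ) + 1) / 24 - 1 / (2 * l)) * B :=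
    mul_le_mul_of_nonneg_left hQ hκ
  have h2 : ((l : ℝ) + 5) / 4 ≤ ((l : ℝ) + 5) / 4 * Real.log Real.pi := by
    have : (0 : ℝ) ≤ ((l : ℝ) + 5) / 4 := by positivity
    nlinarith
  linarith

/-! ## 2. `k = 2` (`λ₂ = 53/98`, triple `45 + 8·1 = 53` scaled: `45 + 53 = 98`; bad primes `{3, 5, 7, 53}`) -/

/-- `k = 2`: **`15 ≤ log q^{∤{2,l}}(λ₂)` at every prime `l`** (`M = 53²`: `e^{15}·2809 < 3269018·2809 ≤ D = 13657428225`).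
[cite: Mochizuki2012, IUTchIV Thm 1.10 p.23] [claim: Mochizuki2012, status: disputed] -/
theorem fifteen_le_logQAvoid_lamSeven_two {l : ℕ} (hl : l.Prime) :
    15 ≤ logQAvoid (ratPoint ((2 : ℚ)⁻¹ + 2 / 7 ^ 2)) {2, l} := by
  refine le_logQAvoid_ratPoint_two_prime_of_certificate (N := 24077483805376) (D := 13657428225) (M := 2809)
    (I := {3, 5, 7, 53}) (e := fun p => if p = 3 then 4 else if p = 7 then 4 else 2)
    (by
      intro p hp
      simp only [Finset.mem_insert, Finset.mem_singleton] at hp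
      rcases hp with rfl | rfl | rfl | rfl <;> norm_num)
    (by rw [Finset.prod_insert (by decide), Finset.prod_insert (by decide), Finset.prod_insert (by decide), Finset.prod_singleton]; norm_num)
    (by norm_num [jInv]) (by norm_num) (by decide) (by norm_num) ?_ hl
  have h := mul_lt_mul_of_pos_right exp_fifteen_lt (by norm_num : (0 : ℝ) < 2809)
  push_cast
  linarith

/-- `k = 2`, the pole `l = 5` EXACTLY: **`20 ≤ log q^{∤{2,5}}(λ₂)`** (`q^{∤{2,5}} = 3⁴·7⁴·53² = 546297129 > 485165196 > e^{20}`).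
[cite: Mochizuki2012, IUTchIV Cor 2.2 (ii) proof (P5) p.46] [claim: Mochizuki2012, status: disputed] -/
theorem twenty_le_logQAvoid_lamSeven_two_five :
    20 ≤ logQAvoid (ratPoint ((2 : ℚ)⁻¹ + 2 / 7 ^ 2)) {2, 5} := by
  refine le_logQAvoid_ratPoint_two_prime_of_mem (N := 24077483805376) (D := 13657428225)
    (I := {3, 5, 7, 53}) (e := fun p => if p = 3 then 4 else if p = 7 then 4 else 2)
    (by
      intro p hp
      simp only [Finset.mem_insert, Finset.mem_singleton] at hp
      rcases hp with rfl | rfl | rfl | rfl <;> norm_num)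
    (by rw [Finset.prod_insert (by decide), Finset.prod_insert (by decide), Finset.prod_insert (by decide), Finset.prod_singleton]; norm_num)
    (by norm_num [jInv]) (by norm_num) (by decide) (by norm_num) (by decide) ?_
  have h := mul_lt_mul_of_pos_right exp_twenty_lt (by norm_num : (0 : ℝ) < 25)
  push_cast
  norm_num
  linarith

/-! ## 3. `k = 1` (`λ₁ = 11/14`, triple `3 + 11 = 14`; bad primes `{3, 7, 11}`): the exact values by gen 11's `Hex1.logQAvoid_pair_of_prime` -/

/-- `log 3 + (log 7 + log 11) = log 231`. [folklore] -/
private theorem log_sum_231 : Real.log 3 + (Real.log 7 + Real.log 11) = Real.log 231 := by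
  rw [← Real.log_mul (by norm_num) (by norm_num), ← Real.log_mul (by norm_num) (by norm_num)]; norm_num

/-- `k = 1`, `l = 5`: `log q^{∤{2,5}}(11/14) = 2·log 231 ≤ 16·log 2 < 11.1`. [cite: Mochizuki2012, IUTchIV Thm 1.10 p.23] [claim: Mochizuki2012, status: disputed] -/
theorem logQAvoid_hexOne_five_le : logQAvoid (ratPoint ((11 : ℚ) / 14)) {2, 5} ≤ 11.1 := by
  rw [Hex1.logQAvoid_pair_of_prime (by norm_num : Nat.Prime 5),
    show ({3, 7, 11} : Finset ℕ).erase 5 = {3, 7, 11} from by decide,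
    Finset.sum_insert (by decide), Finset.sum_insert (by decide), Finset.sum_singleton]
  have h231 : Real.log 231 ≤ 8 * Real.log 2 := by
    rw [show (8 : ℝ) * Real.log 2 = Real.log (2 ^ 8) by rw [Real.log_pow]; norm_num]
    exact Real.log_le_log (by norm_num) (by norm_num)
  have h2 := Real.log_two_lt_d9
  have hs := log_sum_231
  push_cast
  linarith

/-- `k = 1`, the pole `l = 7`: `log q^{∤{2,7}}(11/14) = 2·log 33 ≤ 12·log 2 < 8.32`. [cite: Mochizuki2012, IUTchIV Cor 2.2 (ii) proof (P5) p.46]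
[claim: Mochizuki2012, status: disputed] -/
theorem logQAvoid_hexOne_seven_le : logQAvoid (ratPoint ((11 : ℚ) / 14)) {2, 7} ≤ 8.32 := by
  rw [Hex1.logQAvoid_pair_of_prime (by norm_num : Nat.Prime 7),
    show ({3, 7, 11} : Finset ℕ).erase 7 = {3, 11} from by decide,
    Finset.sum_insert (by decide), Finset.sum_singleton]
  have h33 : Real.log 3 + Real.log 11 ≤ 6 * Real.log 2 := by
    rw [← Real.log_mul (by norm_num) (by norm_num),
      show (6 : ℝ) * Real.log 2 = Real.log (2 ^ 6) by rw [Real.log_pow]; norm_num]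
    exact Real.log_le_log (by norm_num) (by norm_num)
  have h2 := Real.log_two_lt_d9
  push_cast
  linarith

/-- `k = 1`, off the poles (`l` prime, `l ≥ 13`): `log q^{∤{2,l}}(11/14) = 2·log 231 ≥ 10` (`e⁵ < 148.5 < 231`).
[cite: Mochizuki2012, IUTchIV Thm 1.10 p.23] [claim: Mochizuki2012, status: disputed] -/
theorem ten_le_logQAvoid_hexOne {l : ℕ} (hl : l.Prime) (h13 : 13 ≤ l) :
    10 ≤ logQAvoid (ratPoint ((11 : ℚ) / 14)) {2, l} := by
  have hnot : l ∉ ({3, 7, 11} : Finset ℕ) := by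
    simp only [Finset.mem_insert, Finset.mem_singleton]; omega
  rw [Hex1.logQAvoid_pair_of_prime hl, Finset.erase_eq_of_notMem hnot,
    Finset.sum_insert (by decide), Finset.sum_insert (by decide), Finset.sum_singleton]
  have h231 : (5 : ℝ) ≤ Real.log 231 := by
    rw [Real.le_log_iff_exp_le (by norm_num)]
    have := exp_five_lt
    linarith
  have hs := log_sum_231
  push_cast
  linarith

/-! ## 4. The decisions -/

/-- **`k = 1` (`λ = 11/14`): for a prime `l ≥ 5`, the Szpiro-SHALLOW inequality holds IFF `l ≤ 11`** (i.e. exactly at `l ∈ {5, 7, 11}`;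
`l = 11` is gen 11's `Hex1.shallow_eleven`). [cite: Mochizuki2012, IUTchIV Thm. 1.10 Step (viii) p. 30] [claim: Mochizuki2012, status: disputed] -/
theorem shallow_hexOne_iff {l : ℕ} (hl : l.Prime) (h5 : 5 ≤ l) :
    ((((l : ℝ) + 1) / 24 - 1 / (2 * l)) * logQAvoid (ratPoint ((11 : ℚ) / 14)) {2, l} ≤ ((l : ℝ) + 5) / 4 * Real.log Real.pi) ↔
      l ≤ 11 := by
  constructor
  · intro h
    by_contra hle
    have h13 : 13 ≤ l := by
      by_contra h13
      interval_cases l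
      exact absurd hl (by norm_num)
    exact not_shallow_of_le (l₀ := 13) (Q₀ := 10) (by norm_num) (by norm_num) (by norm_num) (by exact_mod_cast h13)
      (ten_le_logQAvoid_hexOne hl h13) h
  · intro hle
    interval_cases l
    · exact shallow_of_le (B := 11.1) (by norm_num) logQAvoid_hexOne_five_le (by norm_num)
    · exact absurd hl (by norm_num)
    · exact shallow_of_le (B := 8.32) (by norm_num) logQAvoid_hexOne_seven_le (by norm_num)
    · exact absurd hl (by norm_num)
    · exact absurd hl (by norm_num)
    · exact absurd hl (by norm_num)
    · exact Hex1.shallow_eleven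

/-- **THE HEX FAMILY `2 ≤ k ≤ 16` IS NEVER SHALLOW: for every prime `l ≥ 5` the Szpiro-shallow inequality FAILS at `λ_k = 1/2 + 2/7^k`**
(`k ≥ 3`: `Q ≥ 20` at every `l`, base `(5, 20)`; `k = 2`: `Q ≥ 15` at every `l`, base `(7, 15)`, and `Q ≥ 20` at the pole `l = 5`).
[cite: Mochizuki2012, IUTchIV Thm. 1.10 Step (viii) p. 30] [claim: Mochizuki2012, status: disputed] -/
theorem not_shallow_lamSeven {k : ℕ} (hk2 : 2 ≤ k) (hk : k ≤ 16) {l : ℕ} (hl : l.Prime) (h5 : 5 ≤ l) :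
    ¬ ((((l : ℝ) + 1) / 24 - 1 / (2 * l)) * logQAvoid (ratPoint ((2 : ℚ)⁻¹ + 2 / 7 ^ k)) {2, l} ≤
        ((l : ℝ) + 5) / 4 * Real.log Real.pi) := by
  rcases Nat.lt_or_ge k 3 with hk3 | hk3
  · obtain rfl : k = 2 := by omega
    rcases Nat.lt_or_ge l 7 with hl7 | hl7
    · interval_cases l
      · exact not_shallow_of_le (l₀ := 5) (Q₀ := 20) (by norm_num) (by norm_num) (by norm_num) (by norm_num)
          twenty_le_logQAvoid_lamSeven_two_five
      · exact absurd hl (by norm_num)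
    · exact not_shallow_of_le (l₀ := 7) (Q₀ := 15) (by norm_num) (by norm_num) (by norm_num) (by exact_mod_cast hl7)
        (fifteen_le_logQAvoid_lamSeven_two hl)
  · exact not_shallow_of_le (l₀ := 5) (Q₀ := 20) (by norm_num) (by norm_num) (by norm_num) (by exact_mod_cast h5)
      (twenty_le_logQAvoid_lamSeven_of_le_sixteen hk3 hk hl)

end HexPrintIsm

end Literature.IUT.LogVolume.Cor22

end
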